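import Mathlib
import Summits.Ventures.HodgeRepro.Tier4.Target
import Summits.Ventures.HodgeRepro.Tier4.Common.TargetBall
import Summits.Ventures.HodgeRepro.Tier4.Common.TargetCalculus
import Summits.Ventures.HodgeRepro.Tier4.Common.TargetJacobian
import Summits.Ventures.HodgeRepro.Tier4.Common.AutForms
import Summits.Ventures.HodgeRepro.Tier4.Line3.KMDatum
import Summits.Ventures.HodgeRepro.Tier4.Line3.KMDatumS
import Summits.Ventures.HodgeRepro.Tier4.Line3.Defs
import Summits.Ventures.HodgeRepro.Tier4.Line3.HeckeEquivarianceLemmas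
import Summits.Ventures.HodgeRepro.Tier4.Line3.WittRank3
import Summits.Ventures.HodgeRepro.Tier4.Line3.BallChangeOfVariables
import Summits.Ventures.HodgeRepro.Tier4.Line3.DomainTransfer
import Summits.Ventures.HodgeRepro.Tier4.Line3.ScalarAction
import Summits.Ventures.HodgeRepro.Tier4.Line3.FibreCount
import Summits.Ventures.HodgeRepro.Tier4.Line3.KernelEquivariance
import Summits.Ventures.HodgeRepro.Tier4.Line3.CoefInvariance
import Summits.Ventures.HodgeRepro.Tier4.Line3.TorusInvariance
import Summits.Ventures.HodgeRepro.Tier4.Line3.ClassRegrouping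
import Summits.Ventures.HodgeRepro.Tier4.Line3.MainClassReps
import Summits.Ventures.HodgeRepro.Tier4.Line3.ClassFibres
import Summits.Ventures.HodgeRepro.Tier4.Line3.CentreFibres
import Summits.Ventures.HodgeRepro.Tier4.Line3.CentreFinite
import Summits.Ventures.HodgeRepro.Tier4.Line3.StabFiniteApi

/-!
# Tier4/Line3/MainTermAssembly — L3.6a assembled, modulo the stabiliser finiteness and two interchanges

Blind re-derivation cell `pub-hodge-repro`, Tier 4 «PROVE THE STEP» (README §9–§10), LINE L3, seat t4-L3-p1 (prover);
the assembly of L3.6a `term_main_unfold` from the support modules (proofs/t4/L3/L36a-support.md), with the three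
residual inputs DISPLAYED as hypotheses of the lemma (never of `P_T4`):

* `hfin`: the stabiliser `Stab(mainRep c)` of every main class is FINITE — DISCHARGED by `StabFiniteApi.finite_stab_mainRep` (t4-L3-p2, p668590)
  for `xm` with independent `xm 0, xm 1` (`term_main_unfold_of'`);
* `hI1`, `hI2`: the interchanges `∫_D Σ'_c = Σ'_c ∫_D` over the classes and `∫_D Σ'_{γ ∈ Γ′} = Σ'_γ ∫_D` over `Γ′`
  (residual R-d: `MeasureTheory.integral_tsum` with the majorant of `h2`);
* `hint`: integrability of `kernel (mainRep c, ·)` on the ball (L3.7's first conjunct, transported).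

**`term_main_unfold_of`**: under these, `term K γ [xm] = (∫_𝔹 kernel xm) · classSum γ xm` — the statement of L3.6a.

Nothing here asserts anything about the truth of (P); HC_CM is NOT proved by anyone in this repository.
-/

set_option autoImplicit false

noncomputable section

namespace Summit.Ventures.HodgeRepro.Tier4.Line3

open Summit.Ventures.HodgeRepro.Tier4
open Matrix MeasureTheory
open HeckeEquivariance

/-- `FibreCount` with `Finite` fibres and `Nat.card`. -/
theorem tsum_comp_eq_natCard_mul_tsum {A B : Type*} (F : A → B) (n : ℕ) [∀ b, Finite {a // F a = b}]
    (hn : ∀ b, Nat.card {a // F a = b} = n) {g : B → ℂ} (hg : Summable fun b => ‖g b‖) :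
    ∑' a, g (F a) = (n : ℂ) * ∑' b, g b := by
  letI : ∀ b, Fintype {a // F a = b} := fun b => Fintype.ofFinite _
  exact tsum_comp_eq_card_smul_tsum F n (fun b => by rw [Fintype.card_eq_nat_card]; exact hn b) hg

namespace T4Data

variable (X : T4Data)

/-! ## 1. The class map `Γ′ → c` and its fibres -/

/-- The class map `Γ′ → (class c)`, `γ ↦ lines (γ • mainRep c)`. -/
def classMap (K : X.Level) (xm : X.Tuple) (c : X.MainClass K xm) (γ : {γ : Matrix (Fin 3) (Fin 3) X.E // γ ∈ K.1}) :
    {w : X.LineTuple // X.classOf K w = c.1} :=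
  ⟨X.orbitMap K (X.mainRep K xm c) γ, (X.mem_class_iff K xm c _).mpr ⟨γ.1, γ.2, rfl⟩⟩

/-- The class map is surjective. -/
theorem classMap_surjective (K : X.Level) (xm : X.Tuple) (c : X.MainClass K xm) :
    Function.Surjective (X.classMap K xm c) := by
  rintro ⟨w, hw⟩
  obtain ⟨γ, hγ, rfl⟩ := (X.mem_class_iff K xm c w).mp hw
  exact ⟨⟨γ, hγ⟩, rfl⟩

/-- The fibres of the class map are the fibres of the orbit map. -/
def classMapFibreEquiv (K : X.Level) (xm : X.Tuple) (c : X.MainClass K xm)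
    (γ₀ : {γ : Matrix (Fin 3) (Fin 3) X.E // γ ∈ K.1}) :
    {γ : {γ : Matrix (Fin 3) (Fin 3) X.E // γ ∈ K.1} // X.classMap K xm c γ = X.classMap K xm c γ₀} ≃
      X.Stab K (X.mainRep K xm c) :=
  (Equiv.subtypeEquivRight fun γ => by
    constructor
    · intro h; exact congrArg Subtype.val h
    · intro h; exact Subtype.ext h).trans (X.fibreEquivStab K (X.mainRep K xm c) γ₀)

/-- Every fibre of the class map has `Nat.card = stabCard`. -/
theorem natCard_classMap_fibre (K : X.Level) (xm : X.Tuple) (c : X.MainClass K xm)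
    (w : {w : X.LineTuple // X.classOf K w = c.1}) :
    Nat.card {γ : {γ : Matrix (Fin 3) (Fin 3) X.E // γ ∈ K.1} // X.classMap K xm c γ = w} =
      X.stabCard K (X.mainRep K xm c) := by
  obtain ⟨γ₀, rfl⟩ := X.classMap_surjective K xm c w
  exact Nat.card_congr (X.classMapFibreEquiv K xm c γ₀)

/-- The fibres of the class map are finite when the stabiliser is. -/
theorem finite_classMap_fibre (K : X.Level) (xm : X.Tuple) (c : X.MainClass K xm)
    [Finite (X.Stab K (X.mainRep K xm c))] (w : {w : X.LineTuple // X.classOf K w = c.1}) :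
    Finite {γ : {γ : Matrix (Fin 3) (Fin 3) X.E // γ ∈ K.1} // X.classMap K xm c γ = w} := by
  obtain ⟨γ₀, rfl⟩ := X.classMap_surjective K xm c w
  exact Finite.of_equiv _ (X.classMapFibreEquiv K xm c γ₀).symm

/-- The stabiliser is non-empty (`1`), so `stabCard ≠ 0` when it is finite. -/
theorem stabCard_ne_zero (K : X.Level) (x : X.Tuple) [Finite (X.Stab K x)] : X.stabCard K x ≠ 0 := by
  have hne : Nonempty (X.Stab K x) := ⟨⟨1, K.2.1.1, by simp [Matrix.one_mulVec]⟩⟩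
  unfold T4Data.stabCard
  exact Nat.card_ne_zero.mpr ⟨hne, inferInstance⟩

/-! ## 2. The sum over a class as a sum over `Γ′` -/

/-- The summand at `classMap γ` is `coefQ (mainRep c) · kernel (γ • mainRep c, z)`. -/
theorem summand_classMap (D : X.ThetaData) {K : X.Level} (γ : X.Tr K) (xm : X.Tuple) (c : X.MainClass K xm)
    (g : {γ : Matrix (Fin 3) (Fin 3) X.E // γ ∈ K.1}) (z : Fin 2 → ℂ) :
    X.summand D.Φ D.cf γ (X.classMap K xm c g).1 z =
      X.coefQ D.cf γ (X.mainRep K xm c) * X.kernel D.Φ (fun j => g.1 *ᵥ X.mainRep K xm c j) z := by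
  show X.summand D.Φ D.cf γ (X.lines (fun j => g.1 *ᵥ X.mainRep K xm c j)) z = _
  rw [X.summand_eq_of_lines_eq D.Φ D.cf D.weight γ (x := fun j => g.1 *ᵥ X.mainRep K xm c j) rfl z,
    X.coefQ_mulVec_mem_of_thetaData D γ g.2]

/-- **THE CLASS SUM AS A `Γ′`-SUM**: `Σ'_{w ∈ c} summand w z = (1 / stabCard) · coefQ (x_c) · Σ'_{γ ∈ Γ′} kernel (γ • x_c, z)`. -/
theorem tsum_class_eq (D : X.ThetaData) {K : X.Level} (γ : X.Tr K) (xm : X.Tuple) (c : X.MainClass K xm)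
    [Finite (X.Stab K (X.mainRep K xm c))] (z : Fin 2 → ℂ)
    (hs : Summable fun w : X.LineTuple => ‖X.summand D.Φ D.cf γ w z‖) :
    ∑' w : {w : X.LineTuple // X.classOf K w = c.1}, X.summand D.Φ D.cf γ w.1 z =
      ((X.stabCard K (X.mainRep K xm c) : ℂ))⁻¹ * X.coefQ D.cf γ (X.mainRep K xm c) *
        ∑' g : {γ : Matrix (Fin 3) (Fin 3) X.E // γ ∈ K.1}, X.kernel D.Φ (fun j => g.1 *ᵥ X.mainRep K xm c j) z := by
  haveI : ∀ w : {w : X.LineTuple // X.classOf K w = c.1},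
      Finite {g : {γ : Matrix (Fin 3) (Fin 3) X.E // γ ∈ K.1} // X.classMap K xm c g = w} :=
    fun w => X.finite_classMap_fibre K xm c w
  have hsub : Summable fun w : {w : X.LineTuple // X.classOf K w = c.1} => ‖X.summand D.Φ D.cf γ w.1 z‖ :=
    hs.subtype _
  have h := tsum_comp_eq_natCard_mul_tsum (X.classMap K xm c) (X.stabCard K (X.mainRep K xm c))
    (X.natCard_classMap_fibre K xm c) hsub
  simp only [X.summand_classMap D γ xm c] at h
  rw [tsum_mul_left] at h
  have hn : (X.stabCard K (X.mainRep K xm c) : ℂ) ≠ 0 := by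
    exact_mod_cast X.stabCard_ne_zero K (X.mainRep K xm c)
  rw [mul_assoc, h, ← mul_assoc, inv_mul_cancel₀ hn, one_mul]

/-! ## 3. The `Γ′`-sum of the kernel integrals: change of variables and the centre count -/

/-- The inverse in `Γ′`, as an involution of the subtype. -/
def invEquiv (K : X.Level) : {γ : Matrix (Fin 3) (Fin 3) X.E // γ ∈ K.1} ≃ {γ : Matrix (Fin 3) (Fin 3) X.E // γ ∈ K.1} where
  toFun g := ⟨g.1⁻¹, by
    obtain ⟨g', hg', hgg', hg'g⟩ := exists_inv_mem K.2.1 g.2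
    have hd : IsUnit g.1.det := (Matrix.isUnit_iff_isUnit_det _).mp ⟨⟨g.1, g', hgg', hg'g⟩, rfl⟩
    have : g.1⁻¹ = g' := by
      calc g.1⁻¹ = g.1⁻¹ * (g.1 * g') := by rw [hgg', Matrix.mul_one]
        _ = g' := by rw [← Matrix.mul_assoc, Matrix.nonsing_inv_mul _ hd, Matrix.one_mul]
    rw [this]; exact hg'⟩
  invFun g := ⟨g.1⁻¹, by
    obtain ⟨g', hg', hgg', hg'g⟩ := exists_inv_mem K.2.1 g.2
    have hd : IsUnit g.1.det := (Matrix.isUnit_iff_isUnit_det _).mp ⟨⟨g.1, g', hgg', hg'g⟩, rfl⟩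
    have : g.1⁻¹ = g' := by
      calc g.1⁻¹ = g.1⁻¹ * (g.1 * g') := by rw [hgg', Matrix.mul_one]
        _ = g' := by rw [← Matrix.mul_assoc, Matrix.nonsing_inv_mul _ hd, Matrix.one_mul]
    rw [this]; exact hg'⟩
  left_inv g := by
    obtain ⟨g', hg', hgg', hg'g⟩ := exists_inv_mem K.2.1 g.2
    have hd : IsUnit g.1.det := (Matrix.isUnit_iff_isUnit_det _).mp ⟨⟨g.1, g', hgg', hg'g⟩, rfl⟩
    exact Subtype.ext (Matrix.nonsing_inv_nonsing_inv _ hd)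
  right_inv g := by
    obtain ⟨g', hg', hgg', hg'g⟩ := exists_inv_mem K.2.1 g.2
    have hd : IsUnit g.1.det := (Matrix.isUnit_iff_isUnit_det _).mp ⟨⟨g.1, g', hgg', hg'g⟩, rfl⟩
    exact Subtype.ext (Matrix.nonsing_inv_nonsing_inv _ hd)

/-- `∫_D kernel (g • x, ·) = ∫_{M(g⁻¹) D} kernel (x, ·)` for `g ∈ Γ′`. -/
theorem integral_kernel_mulVec_eq_image (D : X.ThetaData) (K : X.Level) {S : Set (Fin 2 → ℂ)}
    (hS : MeasurableSet S) (hSb : S ⊆ ball) (g : {γ : Matrix (Fin 3) (Fin 3) X.E // γ ∈ K.1}) (x : X.Tuple) :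
    ∫ z in S, X.kernel D.Φ (fun j => g.1 *ᵥ x j) z =
      ∫ z in actM (toBallMat X.τ₀ X.C (X.invEquiv K g).1) '' S, X.kernel D.Φ x z := by
  have hg' : (X.invEquiv K g).1 ∈ K.1 := (X.invEquiv K g).2
  have hu' : IsUnitaryOf X.c X.H (X.invEquiv K g).1 := isUnitaryOf_of_mem_level X K hg'
  have hM' : (toBallMat X.τ₀ X.C (X.invEquiv K g).1)ᴴ * J * toBallMat X.τ₀ X.C (X.invEquiv K g).1 = J :=
    toBallMat_J_of_unitary X hu'
  rw [integral_image_actM hM' hS hSb]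
  refine setIntegral_congr_fun hS fun z hz => ?_
  have h := X.kernel_equiv D hu' (fun j => g.1 *ᵥ x j) (hSb hz)
  -- `g⁻¹ • (g • x) = x`
  have hd : IsUnit g.1.det := by
    obtain ⟨g', hg', hgg', hg'g⟩ := exists_inv_mem K.2.1 g.2
    exact (Matrix.isUnit_iff_isUnit_det _).mp ⟨⟨g.1, g', hgg', hg'g⟩, rfl⟩
  have hx : (fun j => (X.invEquiv K g).1 *ᵥ (g.1 *ᵥ x j)) = x := by
    funext j
    show g.1⁻¹ *ᵥ (g.1 *ᵥ x j) = x j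
    rw [Matrix.mulVec_mulVec, Matrix.nonsing_inv_mul _ hd, Matrix.one_mulVec]
  rw [hx] at h
  exact h

/-- The tiles `φ '' D` are measurable and the family `φ ↦ ∫_{φ D} ‖k‖` is summable (from `hasSum_integral_iUnion_ae`). -/
theorem summable_norm_integral_image (K : X.Level) {D : Set (Fin 2 → ℂ)}
    (hD : IsFundamentalDomainFor (ballActions X.τ₀ X.C K.1) D) {k : (Fin 2 → ℂ) → ℂ} (hk : IntegrableOn k ball) :
    Summable fun φ : ballActions X.τ₀ X.C K.1 => ‖∫ z in φ.1 '' D, k z‖ := by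
  have hτ : ∀ x, X.τ₀ (X.c x) = (starRingEnd ℂ) (X.τ₀ x) := fun x => complexConj_intertwines X.E X.τ₀ x
  haveI : Countable (ballActions X.τ₀ X.C K.1) := countable_ballActions
  have hmeas : ∀ φ : ballActions X.τ₀ X.C K.1, MeasurableSet (φ.1 '' D) := by
    intro φ
    obtain ⟨M, hM, hφ⟩ := exists_unitaryJ_of_mem_ballActions K.2.1 hτ X.hC φ.2
    rw [hφ]
    exact measurableSet_image_actM hM hD.1 hD.2.1
  have hsub : (⋃ φ : ballActions X.τ₀ X.C K.1, φ.1 '' D) ⊆ ball :=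
    Set.iUnion_subset fun φ => image_subset_ball K.2.1 hτ X.hC φ.2 hD.2.1
  have hnorm : IntegrableOn (fun z => ‖k z‖) (⋃ φ : ballActions X.τ₀ X.C K.1, φ.1 '' D) :=
    IntegrableOn.mono_set (Integrable.norm hk) hsub
  have hs := hasSum_integral_iUnion_ae (fun φ => (hmeas φ).nullMeasurableSet)
    (fun φ ψ hne => hD.2.2.2 φ.1 φ.2 ψ.1 ψ.2 (fun h => hne (Subtype.ext h))) hnorm
  refine Summable.of_nonneg_of_le (fun φ => norm_nonneg _) (fun φ => ?_) hs.summable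
  exact norm_integral_le_integral_norm _

/-- **THE `Γ′`-SUM OF THE KERNEL INTEGRALS OVER `D` IS `centerCard · ∫_𝔹 kernel`**. -/
theorem tsum_integral_kernel_mulVec (D : X.ThetaData) (K : X.Level) {Dom : Set (Fin 2 → ℂ)}
    (hD : IsFundamentalDomainFor (ballActions X.τ₀ X.C K.1) Dom) (x : X.Tuple)
    (hint : IntegrableOn (fun z => X.kernel D.Φ x z) ball) :
    ∑' g : {γ : Matrix (Fin 3) (Fin 3) X.E // γ ∈ K.1}, ∫ z in Dom, X.kernel D.Φ (fun j => g.1 *ᵥ x j) z =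
      (X.centerCard K : ℂ) * ∫ z in ball, X.kernel D.Φ x z := by
  have hτ : ∀ y, X.τ₀ (X.c y) = (starRingEnd ℂ) (X.τ₀ y) := fun y => complexConj_intertwines X.E X.τ₀ y
  -- change of variables on each term, then reindex by the inverse
  have h1 : ∀ g : {γ : Matrix (Fin 3) (Fin 3) X.E // γ ∈ K.1},
      ∫ z in Dom, X.kernel D.Φ (fun j => g.1 *ᵥ x j) z =
        ∫ z in (X.actionMap K (X.invEquiv K g)).1 '' Dom, X.kernel D.Φ x z :=
    fun g => X.integral_kernel_mulVec_eq_image D K hD.1 hD.2.1 g x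
  simp_rw [h1]
  have h3 : (∑' g : {γ : Matrix (Fin 3) (Fin 3) X.E // γ ∈ K.1},
        ∫ z in (X.actionMap K (X.invEquiv K g)).1 '' Dom, X.kernel D.Φ x z) =
      ∑' g : {γ : Matrix (Fin 3) (Fin 3) X.E // γ ∈ K.1}, ∫ z in (X.actionMap K g).1 '' Dom, X.kernel D.Φ x z :=
    (X.invEquiv K).tsum_eq (fun g => ∫ z in (X.actionMap K g).1 '' Dom, X.kernel D.Φ x z)
  rw [h3]
  -- the centre count
  haveI : ∀ φ : ballActions X.τ₀ X.C K.1,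
      Finite {g : {γ : Matrix (Fin 3) (Fin 3) X.E // γ ∈ K.1} // X.actionMap K g = φ} := by
    intro φ
    obtain ⟨g₀, rfl⟩ := X.actionMap_surjective K φ
    haveI := X.finite_centre K
    exact Finite.of_equiv _ (X.fibreEquivCentre K g₀).symm
  have hcard : ∀ φ : ballActions X.τ₀ X.C K.1,
      Nat.card {g : {γ : Matrix (Fin 3) (Fin 3) X.E // γ ∈ K.1} // X.actionMap K g = φ} = X.centerCard K := by
    intro φ
    obtain ⟨g₀, rfl⟩ := X.actionMap_surjective K φ
    exact X.natCard_centreFibre K g₀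
  have hsum := X.summable_norm_integral_image K hD hint
  have h2 := tsum_comp_eq_natCard_mul_tsum (X.actionMap K) (X.centerCard K) hcard
    (g := fun φ : ballActions X.τ₀ X.C K.1 => ∫ z in φ.1 '' Dom, X.kernel D.Φ x z) hsum
  rw [h2, ← integral_ball_eq_tsum_image K.2.1 hτ X.hC hD hint]

/-! ## 4. The assembly -/

/-- **PER CLASS**: `∫_D Σ'_{w ∈ c} summand = (centerCard / stabCard) · coefQ (x_c) · ∫_𝔹 kernel xm`. -/
theorem integral_class (D : X.ThetaData) {K : X.Level} (γ : X.Tr K) (xm : X.Tuple) (c : X.MainClass K xm)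
    [Finite (X.Stab K (X.mainRep K xm c))]
    (hD : IsFundamentalDomainFor (ballActions X.τ₀ X.C K.1) (X.domain K))
    (hsum : ∀ z ∈ X.domain K, Summable fun w : X.LineTuple => ‖X.summand D.Φ D.cf γ w z‖)
    (hI2 : ∫ z in X.domain K, ∑' g : {γ : Matrix (Fin 3) (Fin 3) X.E // γ ∈ K.1},
        X.kernel D.Φ (fun j => g.1 *ᵥ X.mainRep K xm c j) z =
      ∑' g : {γ : Matrix (Fin 3) (Fin 3) X.E // γ ∈ K.1},
        ∫ z in X.domain K, X.kernel D.Φ (fun j => g.1 *ᵥ X.mainRep K xm c j) z)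
    (hint : IntegrableOn (fun z => X.kernel D.Φ (X.mainRep K xm c) z) ball) :
    ∫ z in X.domain K, ∑' w : {w : X.LineTuple // X.classOf K w = c.1}, X.summand D.Φ D.cf γ w.1 z =
      ((X.centerCard K : ℂ) / (X.stabCard K (X.mainRep K xm c) : ℂ)) * X.coefQ D.cf γ (X.mainRep K xm c) *
        ∫ z in ball, X.kernel D.Φ xm z := by
  have hcongr : ∫ z in X.domain K, ∑' w : {w : X.LineTuple // X.classOf K w = c.1}, X.summand D.Φ D.cf γ w.1 z =
      ∫ z in X.domain K, ((X.stabCard K (X.mainRep K xm c) : ℂ))⁻¹ * X.coefQ D.cf γ (X.mainRep K xm c) *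
        ∑' g : {γ : Matrix (Fin 3) (Fin 3) X.E // γ ∈ K.1}, X.kernel D.Φ (fun j => g.1 *ᵥ X.mainRep K xm c j) z :=
    setIntegral_congr_fun hD.1 fun z hz => X.tsum_class_eq D γ xm c z (hsum z hz)
  have hk : ∫ z in ball, X.kernel D.Φ (X.mainRep K xm c) z = ∫ z in ball, X.kernel D.Φ xm z :=
    X.integral_kernel_mulVec D (X.gRep_isUnitaryOf K xm c) xm
  rw [hcongr, integral_const_mul, hI2, X.tsum_integral_kernel_mulVec D K hD (X.mainRep K xm c) hint, hk]
  ring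

/-- **L3.6a ASSEMBLED** (`term_main_unfold`, modulo the displayed hypotheses `hfin`, `hI1`, `hI2`, `hint`):
`term K γ [xm] = (∫_𝔹 kernel xm) · classSum γ xm`. -/
theorem term_main_unfold_of (D : X.ThetaData) (xm : X.Tuple) {K : X.Level} (γ : X.Tr K)
    (hD : IsFundamentalDomainFor (ballActions X.τ₀ X.C K.1) (X.domain K))
    (hsum : ∀ z ∈ X.domain K, Summable fun w : X.LineTuple => ‖X.summand D.Φ D.cf γ w z‖)
    (hfin : ∀ c : X.MainClass K xm, Finite (X.Stab K (X.mainRep K xm c)))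
    (hI1 : ∫ z in X.domain K, ∑' c : X.MainClass K xm,
        ∑' w : {w : X.LineTuple // X.classOf K w = c.1}, X.summand D.Φ D.cf γ w.1 z =
      ∑' c : X.MainClass K xm, ∫ z in X.domain K,
        ∑' w : {w : X.LineTuple // X.classOf K w = c.1}, X.summand D.Φ D.cf γ w.1 z)
    (hI2 : ∀ c : X.MainClass K xm, ∫ z in X.domain K, ∑' g : {γ : Matrix (Fin 3) (Fin 3) X.E // γ ∈ K.1},
        X.kernel D.Φ (fun j => g.1 *ᵥ X.mainRep K xm c j) z =
      ∑' g : {γ : Matrix (Fin 3) (Fin 3) X.E // γ ∈ K.1},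
        ∫ z in X.domain K, X.kernel D.Φ (fun j => g.1 *ᵥ X.mainRep K xm c j) z)
    (hint : ∀ c : X.MainClass K xm, IntegrableOn (fun z => X.kernel D.Φ (X.mainRep K xm c) z) ball) :
    X.term D.Φ D.cf K γ (X.orbitOf (X.lines xm)) = (∫ z in ball, X.kernel D.Φ xm z) * X.classSum D.cf γ xm := by
  unfold T4Data.term T4Data.classSum
  have hcongr : ∫ z in X.domain K, ∑' w : {w : X.LineTuple // X.orbitOf w = X.orbitOf (X.lines xm)},
        X.summand D.Φ D.cf γ w.1 z =
      ∫ z in X.domain K, ∑' c : X.MainClass K xm,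
        ∑' w : {w : X.LineTuple // X.classOf K w = c.1}, X.summand D.Φ D.cf γ w.1 z :=
    setIntegral_congr_fun hD.1 fun z hz =>
      X.tsum_mainOrbit_eq_tsum_mainClass K xm (fun w => X.summand D.Φ D.cf γ w z)
        (X.summable_mainOrbit_of_norm xm (hsum z hz))
  rw [hcongr, hI1]
  have hc : ∀ c : X.MainClass K xm,
      ∫ z in X.domain K, ∑' w : {w : X.LineTuple // X.classOf K w = c.1}, X.summand D.Φ D.cf γ w.1 z =
        ((X.centerCard K : ℂ) / (X.stabCard K (X.mainRep K xm c) : ℂ)) * X.coefQ D.cf γ (X.mainRep K xm c) *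
          ∫ z in ball, X.kernel D.Φ xm z := fun c =>
    haveI := hfin c
    X.integral_class D γ xm c hD hsum (hI2 c) (hint c)
  simp_rw [hc]
  rw [tsum_mul_right, mul_comm]

/-- **L3.6a ASSEMBLED, finiteness discharged** (`StabFiniteApi.finite_stab_mainRep`, t4-L3-p2 p668590): for `xm` with independent
`xm 0, xm 1` the stabilisers are finite, so only the two interchanges and the integrability of the kernel remain as
displayed hypotheses. -/
theorem term_main_unfold_of' (D : X.ThetaData) (xm : X.Tuple) (hab : LinearIndependent X.E ![xm 0, xm 1])
    {K : X.Level} (γ : X.Tr K)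
    (hD : IsFundamentalDomainFor (ballActions X.τ₀ X.C K.1) (X.domain K))
    (hsum : ∀ z ∈ X.domain K, Summable fun w : X.LineTuple => ‖X.summand D.Φ D.cf γ w z‖)
    (hI1 : ∫ z in X.domain K, ∑' c : X.MainClass K xm,
        ∑' w : {w : X.LineTuple // X.classOf K w = c.1}, X.summand D.Φ D.cf γ w.1 z =
      ∑' c : X.MainClass K xm, ∫ z in X.domain K,
        ∑' w : {w : X.LineTuple // X.classOf K w = c.1}, X.summand D.Φ D.cf γ w.1 z)
    (hI2 : ∀ c : X.MainClass K xm, ∫ z in X.domain K, ∑' g : {γ : Matrix (Fin 3) (Fin 3) X.E // γ ∈ K.1},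
        X.kernel D.Φ (fun j => g.1 *ᵥ X.mainRep K xm c j) z =
      ∑' g : {γ : Matrix (Fin 3) (Fin 3) X.E // γ ∈ K.1},
        ∫ z in X.domain K, X.kernel D.Φ (fun j => g.1 *ᵥ X.mainRep K xm c j) z)
    (hint : ∀ c : X.MainClass K xm, IntegrableOn (fun z => X.kernel D.Φ (X.mainRep K xm c) z) ball) :
    X.term D.Φ D.cf K γ (X.orbitOf (X.lines xm)) = (∫ z in ball, X.kernel D.Φ xm z) * X.classSum D.cf γ xm :=
  X.term_main_unfold_of D xm γ hD hsum (fun c => X.finite_stab_mainRep K xm hab c) hI1 hI2 hint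

end T4Data

end Summit.Ventures.HodgeRepro.Tier4.Line3

end
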